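import Literature.Algebra.Lie.ChevalleyEilenbergCasimirHomotopy
import HarnessLib

/-!
# Basic cochains for a central element: the relative complex of `𝔨 ⊕ R z`, and
# "a basic cocycle is annihilated by `θ_z`" (the split centre in relative Lie algebra cohomology)

Topic `Algebra/Lie`; namespace `Literature.Algebra.Lie.ChevalleyEilenberg` (continues
`ChevalleyEilenbergComplex`, `…CasimirHomotopy`).  One definition with body (`centralSup`) and
theorems; no named fact, no `sorry`.

For a reductive `𝔤 = 𝔪 ⊕ 𝔞` with `𝔞 = R z` CENTRAL (the Lie algebra of the split component of the
centre), [cite: BorelWallach2000, I §1.3] computes `C^•(𝔤, 𝔨; V) = C^•(𝔪, 𝔨; V) ⊗ Λ^• 𝔞^*` when `𝔞`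
acts trivially, so that the `(𝔪, 𝔨)`-complex is the subcomplex of BASIC cochains `i_z η = 0`.
Inside the tree's relative complex `Subcomplex.rel R L M K` of a Lie subalgebra `K` (`𝔨`) this
reads, for `z` central:

* `centralSup K z hz` — the Lie subalgebra `K + R z` (a subalgebra because `z` is central);
  `mem_centralSup_iff`, `le_centralSup`, `self_mem_centralSup`;
* `mem_rel_centralSup_succ_iff` — a cochain of positive degree is relative for `K + R z` iff it is
  relative for `K`, basic (`i_z η = 0`) and annihilated by `θ_z` (degree `0`:
  `mem_rel_centralSup_zero_iff`);
* `lieDer_eq_zero_of_ins_eq_zero_of_d_eq_zero` — Cartan's formula `θ_z = i_z d + d i_z`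
  [cite: BorelWallach2000, I §1.1 (5)]: a BASIC COCYCLE is annihilated by `θ_z`; hence
  (`smul_eq_zero_of_basic_cocycle`) if the central `z` acts on `M` by the scalar `μ`, then
  `μ • η = 0` — a non-zero basic cocycle forces `μ = 0` ("`𝔞` acts trivially whenever there is
  cohomology"); and (`basic_cocycle_mem_cocycles_rel_centralSup`) a basic cocycle of
  `C^•(L, K; M)` is a cocycle of `C^•(L, K + R z; M)`, while coboundaries only grow
  (`coboundaries_rel_centralSup_le`); `smul_eq_zero_of_basic_cocycle'`,
  `scalar_eq_zero_of_basic_cocycle_ne_zero` — the same for scalars `μ` in a monoid / division ring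
  `S` acting on `M` compatibly (e.g. `S = ℂ` on the complex coefficients of a real Lie algebra:
  a non-zero basic cocycle forces `μ = 0`).

This is Step 0 of Borel's injectivity of cuspidal cohomology in the cone model
(`Literature.NumberTheory.Automorphic.ResGLnCuspidalCohomologyApex`: the complex there is taken
inside all of `𝔤𝔩_n(K_∞) = 𝔪_G ⊕ ℝ Z`, `Z = 1`, with the basic condition `i_Z η = 0`), and the
passage to the pair `(𝔤, 𝔨 ⊕ ℝ Z)` on which Kuga's lemma (`ChevalleyEilenbergKugaAdjoint`) is run
with a basis of the trace-zero hermitian matrices.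

## References

* A. Borel, N. Wallach, *Continuous cohomology, discrete subgroups, and representations of reductive
  groups*, 2nd ed. (2000), I §1.1 (5), §1.3 (held). [BorelWallach2000]
-/

namespace Literature.Algebra.Lie.ChevalleyEilenberg

variable {R : Type*} [CommRing R] {L : Type*} [LieRing L] [LieAlgebra R L]
  {M : Type*} [AddCommGroup M] [Module R M]

/-! ### The subalgebra `K + R z` of a central element -/

section CentralSup

variable (K : LieSubalgebra R L) (z : L)

/-- **The Lie subalgebra `K + R z`** generated by a Lie subalgebra `K` and a CENTRAL element `z`
(its underlying submodule is `K ⊔ R ∙ z`; closed under the bracket because `z` is central).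
[cite: BorelWallach2000, I §1.3] -/
def centralSup (hz : ∀ x : L, ⁅z, x⁆ = 0) : LieSubalgebra R L :=
  { (K.toSubmodule ⊔ R ∙ z : Submodule R L) with
    lie_mem' := by
      intro a b ha hb
      change a ∈ K.toSubmodule ⊔ R ∙ z at ha
      change b ∈ K.toSubmodule ⊔ R ∙ z at hb
      change ⁅a, b⁆ ∈ K.toSubmodule ⊔ R ∙ z
      obtain ⟨k, hk, u, hu, rfl⟩ := Submodule.mem_sup.1 ha
      obtain ⟨k', hk', u', hu', rfl⟩ := Submodule.mem_sup.1 hb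
      obtain ⟨c, rfl⟩ := Submodule.mem_span_singleton.1 hu
      obtain ⟨c', rfl⟩ := Submodule.mem_span_singleton.1 hu'
      have hzk' : ⁅z, k'⁆ = 0 := hz k'
      have hkz : ⁅k, z⁆ = 0 := by rw [← lie_skew, hz, neg_zero]
      have hzz : ⁅z, z⁆ = 0 := lie_self z
      have h1 : ⁅k + c • z, k' + c' • z⁆ = ⁅k, k'⁆ := by
        simp only [add_lie, lie_add, smul_lie, lie_smul, hzk', hkz, hzz, smul_zero, add_zero]
      rw [h1]
      exact Submodule.mem_sup_left (K.lie_mem hk hk') }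

variable (hz : ∀ x : L, ⁅z, x⁆ = 0)

/-- Membership in `K + R z`: `y = k + c • z`. [folklore] -/
theorem mem_centralSup_iff (y : L) : y ∈ centralSup K z hz ↔ ∃ k ∈ K, ∃ c : R, y = k + c • z := by
  change y ∈ K.toSubmodule ⊔ R ∙ z ↔ _
  rw [Submodule.mem_sup]
  constructor
  · rintro ⟨k, hk, u, hu, rfl⟩
    obtain ⟨c, rfl⟩ := Submodule.mem_span_singleton.1 hu
    exact ⟨k, hk, c, rfl⟩
  · rintro ⟨k, hk, c, rfl⟩
    exact ⟨k, hk, c • z, Submodule.mem_span_singleton.2 ⟨c, rfl⟩, rfl⟩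

/-- `K ≤ K + R z`. [folklore] -/
theorem le_centralSup : K ≤ centralSup K z hz := fun k hk =>
  (mem_centralSup_iff K z hz k).2 ⟨k, hk, 0, by rw [zero_smul, add_zero]⟩

/-- `z ∈ K + R z`. [folklore] -/
theorem self_mem_centralSup : z ∈ centralSup K z hz :=
  (mem_centralSup_iff K z hz z).2 ⟨0, K.zero_mem, 1, by rw [one_smul, zero_add]⟩

end CentralSup

/-! ### Relative cochains for `K + R z`: relative for `K`, basic, `θ_z`-invariant -/

section Rel

variable [LieRingModule L M] [LieModule R L M]
variable (K : LieSubalgebra R L) {z : L} (hz : ∀ x : L, ⁅z, x⁆ = 0)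

/-- **Positive degree**: `η ∈ C^{q+1}(L, K + R z; M)` iff `η ∈ C^{q+1}(L, K; M)`, `i_z η = 0`
(basic) and `θ_z η = 0`. [cite: BorelWallach2000, I §1.3] -/
theorem mem_rel_centralSup_succ_iff (q : ℕ) (f : Cochain R L M (q + 1)) :
    f ∈ (Subcomplex.rel R L M (centralSup K z hz)).carrier (q + 1) ↔
      f ∈ (Subcomplex.rel R L M K).carrier (q + 1) ∧ ins q z f = 0 ∧ lieDer R L M (q + 1) z f = 0 := by
  rw [Subcomplex.mem_rel_succ_iff, Subcomplex.mem_rel_succ_iff]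
  constructor
  · intro h
    exact ⟨fun x hx => h x (le_centralSup K z hz hx), (h z (self_mem_centralSup K z hz)).2,
      (h z (self_mem_centralSup K z hz)).1⟩
  · rintro ⟨hK, hins, hlie⟩ y hy
    obtain ⟨k, hk, c, rfl⟩ := (mem_centralSup_iff K z hz y).1 hy
    refine ⟨?_, ?_⟩
    · rw [map_add, map_smul, LinearMap.add_apply, LinearMap.smul_apply, (hK k hk).1, hlie, smul_zero, add_zero]
    · rw [ins_add, ins_smul, (hK k hk).2, hins, smul_zero, add_zero]

/-- **Degree `0`**: `f ∈ C⁰(L, K + R z; M)` iff `f ∈ C⁰(L, K; M)` and `θ_z f = 0` (`⁅z, f⁆ = 0`).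
[cite: BorelWallach2000, I §1.3] -/
theorem mem_rel_centralSup_zero_iff (f : Cochain R L M 0) :
    f ∈ (Subcomplex.rel R L M (centralSup K z hz)).carrier 0 ↔
      f ∈ (Subcomplex.rel R L M K).carrier 0 ∧ lieDer R L M 0 z f = 0 := by
  rw [Subcomplex.mem_rel_zero_iff, Subcomplex.mem_rel_zero_iff]
  constructor
  · intro h
    exact ⟨fun x hx => h x (le_centralSup K z hz hx), h z (self_mem_centralSup K z hz)⟩
  · rintro ⟨hK, hlie⟩ y hy
    obtain ⟨k, hk, c, rfl⟩ := (mem_centralSup_iff K z hz y).1 hy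
    rw [map_add, map_smul, LinearMap.add_apply, LinearMap.smul_apply, hK k hk, hlie, smul_zero, add_zero]

/-- **Cartan: a basic cocycle is `θ_z`-invariant** — `θ_z η = i_z (d η) + d (i_z η) = 0` for
`i_z η = 0`, `d η = 0` (any `z`, central or not). [cite: BorelWallach2000, I §1.1 (5)] -/
theorem lieDer_eq_zero_of_ins_eq_zero_of_d_eq_zero (q : ℕ) (z : L)
    (f : Cochain R L M (q + 1)) (hins : ins q z f = 0) (hd : d R L M (q + 1) f = 0) :
    lieDer R L M (q + 1) z f = 0 := by
  have h := ins_d_succ (R := R) (M := M) q z f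
  rw [hd, map_zero, hins, map_zero, sub_zero] at h
  exact h.symm

/-- **The split centre acts trivially as soon as there is a basic cocycle**: if the central `z`
acts on `M` by the scalar `μ`, then `μ • η = 0` for every basic cocycle `η` (`θ_z = μ` on cochains,
`lieDer_eq_post_toEnd_of_central`); so a non-zero basic cocycle over a domain forces `μ = 0`.
[cite: BorelWallach2000, I §1.3] -/
theorem smul_eq_zero_of_basic_cocycle {w : L} (hw : ∀ x : L, ⁅w, x⁆ = 0) {μ : R}
    (hμ : ∀ m : M, ⁅w, m⁆ = μ • m) (q : ℕ) (f : Cochain R L M (q + 1)) (hins : ins q w f = 0)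
    (hd : d R L M (q + 1) f = 0) : μ • f = 0 := by
  have h := lieDer_eq_zero_of_ins_eq_zero_of_d_eq_zero q w f hins hd
  rw [lieDer_eq_post_toEnd_of_central hw (q + 1) f] at h
  rw [← h]
  ext v
  rw [AlternatingMap.smul_apply, post_apply, LieModule.toEnd_apply_apply, hμ]

/-- **Basic cocycles of `C^•(L, K; M)` are cocycles of `C^•(L, K + R z; M)`** (`z` central).
[cite: BorelWallach2000, I §1.3] -/
theorem basic_cocycle_mem_cocycles_rel_centralSup (q : ℕ) (f : Cochain R L M (q + 1))
    (hf : f ∈ (Subcomplex.rel R L M K).cocycles (q + 1)) (hins : ins q z f = 0) :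
    f ∈ (Subcomplex.rel R L M (centralSup K z hz)).cocycles (q + 1) := by
  rw [Subcomplex.mem_cocycles_iff] at hf ⊢
  exact ⟨(mem_rel_centralSup_succ_iff K hz q f).2
    ⟨hf.1, hins, lieDer_eq_zero_of_ins_eq_zero_of_d_eq_zero q z f hins hf.2⟩, hf.2⟩

/-- The relative complex only shrinks when the subalgebra grows: `C^q(L, K + R z; M) ≤ C^q(L, K; M)`.
[folklore] -/
theorem carrier_rel_centralSup_le (q : ℕ) :
    (Subcomplex.rel R L M (centralSup K z hz)).carrier q ≤ (Subcomplex.rel R L M K).carrier q := by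
  intro f hf
  cases q with
  | zero => exact ((mem_rel_centralSup_zero_iff K hz f).1 hf).1
  | succ q => exact ((mem_rel_centralSup_succ_iff K hz q f).1 hf).1

/-- Hence so do the coboundaries: `B^q(L, K + R z; M) ≤ B^q(L, K; M)` — a basic cocycle which is
not a coboundary of `C^•(L, K; M)` is a fortiori not one of `C^•(L, K + R z; M)`. [folklore] -/
theorem coboundaries_rel_centralSup_le (q : ℕ) :
    (Subcomplex.rel R L M (centralSup K z hz)).coboundaries q ≤ (Subcomplex.rel R L M K).coboundaries q := by
  cases q with
  | zero =>
    intro f hf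
    change f ∈ (⊥ : Submodule R (Cochain R L M 0)) at hf
    rw [Submodule.mem_bot] at hf
    rw [hf]
    exact Submodule.zero_mem _
  | succ q =>
    intro f hf
    obtain ⟨g, hg, rfl⟩ := ((Subcomplex.rel R L M (centralSup K z hz)).mem_coboundaries_succ_iff q f).1 hf
    exact ((Subcomplex.rel R L M K).mem_coboundaries_succ_iff q _).2
      ⟨g, carrier_rel_centralSup_le K hz q hg, rfl⟩

end Rel

/-! ### General scalars: a complex Lie module of a real Lie algebra -/

section Scalar

variable [LieRingModule L M] [LieModule R L M]
variable {S : Type*} [Monoid S] [DistribMulAction S M] [SMulCommClass R S M]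

/-- **The split centre acts trivially as soon as there is a basic cocycle — scalars in a larger
monoid**: if the central `w` acts on `M` by `μ • ·` for `μ ∈ S` (e.g. `S = ℂ` on the complex space
`M = W ⊗ E` of a REAL Lie algebra, the setting of `(𝔤, K)`-cohomology), then `μ • η = 0` for every
basic cocycle `η`; over a field `S` acting faithfully, a non-zero basic cocycle forces `μ = 0`.
[cite: BorelWallach2000, I §1.3] -/
theorem smul_eq_zero_of_basic_cocycle' {w : L} (hw : ∀ x : L, ⁅w, x⁆ = 0) {μ : S}
    (hμ : ∀ m : M, ⁅w, m⁆ = μ • m) (q : ℕ) (f : Cochain R L M (q + 1)) (hins : ins q w f = 0)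
    (hd : d R L M (q + 1) f = 0) : μ • f = 0 := by
  have h := lieDer_eq_zero_of_ins_eq_zero_of_d_eq_zero q w f hins hd
  rw [lieDer_eq_post_toEnd_of_central hw (q + 1) f] at h
  rw [← h]
  ext v
  rw [AlternatingMap.smul_apply, post_apply, LieModule.toEnd_apply_apply, hμ]

end Scalar

section Field

variable [LieRingModule L M] [LieModule R L M]
variable {S : Type*} [DivisionRing S] [Module S M] [SMulCommClass R S M]

/-- Hence, for scalars in a division ring `S` (e.g. `S = ℂ`): a NON-ZERO basic cocycle forces the
scalar `μ` by which the central `w` acts to vanish (`μ • η = 0`, `η ≠ 0`, and `μ⁻¹`).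
[cite: BorelWallach2000, I §1.3] -/
theorem scalar_eq_zero_of_basic_cocycle_ne_zero {w : L} (hw : ∀ x : L, ⁅w, x⁆ = 0) {μ : S}
    (hμ : ∀ m : M, ⁅w, m⁆ = μ • m) (q : ℕ) {f : Cochain R L M (q + 1)} (hins : ins q w f = 0)
    (hd : d R L M (q + 1) f = 0) (hf : f ≠ 0) : μ = 0 := by
  by_contra hμ0
  have h := smul_eq_zero_of_basic_cocycle' hw hμ q f hins hd
  apply hf
  have h2 := congrArg (fun g : Cochain R L M (q + 1) => μ⁻¹ • g) h
  simpa only [smul_smul, inv_mul_cancel₀ hμ0, one_smul, smul_zero] using h2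

end Field

end Literature.Algebra.Lie.ChevalleyEilenberg
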